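import Summits.BirchSwinnertonDyer.Rank1Residual.X11b.BDPRouteRelaxationExact
import Summits.BirchSwinnertonDyer.Rank1Residual.X11b.BDPRouteSelmerCountLemmas
import Summits.BirchSwinnertonDyer.Rank1Residual.X11b.BDPRouteSelmerLevelBoundTorsion
import HarnessLib

/-!
# X11b, routes p2/R1 — THE EXACT LEVEL COUNT for Castella's `Sel_𝔭(K, E[p^∞])` (no (iv)):
# `#H¹_{𝓛^{(k)}}(K, E[p^k]) = #Ш[p^∞] · p^{e+s}` from the four symbolic local indices
# (cell `b2b-bsdres`, sub-cell `multr1-p2`, gen 19)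

HONEST FRAMING (verbatim, cell `b2b-bsdres`): "We develop the residual theory around the BSD formula
for a specific rank-1 curve class, assuming the known deep theorems (Gross–Zagier, Kolyvagin,
Kato, Skinner–Urban) as cited black boxes (conditional/label B). No claim of proving BSD outright;
every result is labelled (A) Mathlib-unconditional, (B) conditional on cited literature theorems
stated as hypotheses, or (C) speculative." This file is label **(B)**: CONDITIONAL on the two
textbook named facts `poitouTate_selmerStructure_duality K` (Milne ADT I 4.10, both halves) and
`localEulerPoincareCharacteristic (K_v)` (Milne ADT I 2.8), taken as hypotheses. Nothing booked;
class X11b stays CONSTRUCTION-SHAPED.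

## What this file proves

Gen 17 (`SelmerLevelBound.natCard_level_le_of_indices_torsion`) proved the level bound `≤`. Here,
with the SAME symbolic indices at `𝔭` and BOTH halves of Poitou–Tate (gen 19
`Relaxation.relIndex_selmerGroup_kummerOutside_eq`), for `K` with all infinite places complex,
`p = 𝔭𝔮` (`𝔮 = σ𝔭 ≠ 𝔭`), `E(K)[p] = 0`, `n = p^k`:

  **`natCard_level_eq_of_indices`**: if `[E(K) : nE(K)] = [E(K_𝔭) : T + nE(K_𝔭)] = n`,
  `[E(K_𝔭) : im E(K) + p^{k'}E(K_𝔭)] = p^e` for `k' ∈ {k, k-j}`,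
  `[E(K_𝔭) : im E(K) + T + p^{k'}E(K_𝔭)] = p^s` for `k' ∈ {k, k-e-j}`, `#(Ш ∩ H¹[n]) = S` and
  `p^j (Ш ∩ H¹[n]) = 0` (`s + e + j ≤ k`), then `#H¹_{𝓛^{(k)}}(K, E[p^k]) = S · p^{e+s}` EXACTLY.

Proof (JSW17 Prop. 3.2.1 at finite level, made exact): with `G = H¹(G_{𝔮}, E[n])` (Kummer
everywhere except relaxed at `𝔮`), `Sel = Sel⁽ⁿ⁾`, `C' = G ∩ loc_𝔭⁻¹ κ_𝔭(T)` (`=` Castella's level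
group, gen 19 `LevelKummer.selmerGroup_acLevelStructure_eq_inf_torsion`):
`#C'·[G : C'] = #G = #Sel·[G : Sel]`; `#Sel = n·S` (Kummer sequence, exact);
`[G : Sel] = [𝓛_𝔮 : loc_𝔮 Sel] = p^e` (Poitou–Tate both halves; squeeze of `loc_𝔮 Sel` between
`κ_𝔮(im E(K))` and `κ_𝔮(im E(K) + p^{k-j}E(K_𝔮))`, gen 19 `KummerDecomp`, symmetry `𝔮 ↔ 𝔭`);
`[G : C'] = [κ_𝔭(T) + loc_𝔭 G : κ_𝔭(T)] = p^{k-s}` (squeeze of `loc_𝔭 G` between `κ_𝔭(im E(K))` and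
`κ_𝔭(im E(K) + T + p^{k-e-j}E(K_𝔭))`, using `p^{e+j} G ⊆ κ_n(E(K))`).

References: [JetchevSkinnerWan2017] Prop. 3.2.1 (arXiv:1512.06894 pp. 10–11); [Castella2018]
proof of Thm. 2.3 (3.2.1), (calcul); [MilneADT2006] I 4.10, 2.8, 6.15; [SilvermanAEC2009] X.4.2.
-/

noncomputable section

open scoped Classical

universe u

namespace Summit.BirchSwinnertonDyer.Rank1Residual.X11b.SelmerLevelCount

open WeierstrassCurve NumberField IsDedekindDomain Field Function
open Literature.NumberTheory.EllipticCurves Literature.NumberTheory.EllipticCurves.GreenbergSelmer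
open Literature.NumberTheory.GaloisRepresentations Literature.NumberTheory.GaloisCohomology
open Summit.BirchSwinnertonDyer.Rank1Residual.X11b.AcSelmer
open Summit.BirchSwinnertonDyer.Rank1Residual.X11b.LocBridge

variable (W : WeierstrassCurve ℚ) [W.IsElliptic] (K : Type) [Field K] [NumberField K]
  (p k : ℕ) [Fact p.Prime] (𝔭 𝔮 : HeightOneSpectrum (𝓞 K))

omit [Fact p.Prime] in
/-- For `a ≤ b`: `p^bE ≤ p^aE` (as ranges of `zsmulAddGroupHom`). [folklore] -/
theorem range_zsmul_pow_le_of_le {A : Type*} [AddCommGroup A] {a b : ℕ} (hab : a ≤ b) :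
    (zsmulAddGroupHom ((p ^ b : ℕ) : ℤ) : A →+ A).range ≤
      (zsmulAddGroupHom ((p ^ a : ℕ) : ℤ) : A →+ A).range := by
  rintro _ ⟨P, rfl⟩
  refine ⟨((p ^ (b - a) : ℕ) : ℤ) • P, ?_⟩
  change ((p ^ a : ℕ) : ℤ) • (((p ^ (b - a) : ℕ) : ℤ) • P) = ((p ^ b : ℕ) : ℤ) • P
  rw [smul_smul, ← Nat.cast_mul, ← pow_add, Nat.add_sub_cancel' hab]

/-- **THE EXACT LEVEL COUNT (JSW17 Prop. 3.2.1 `=` at level `p^k`, indices symbolic, no (iv)).**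
See the module docstring. CONDITIONAL on `poitouTate_selmerStructure_duality K` and
`localEulerPoincareCharacteristic (K_v)` (all finite `v`), hypotheses.
[cite: JetchevSkinnerWan2017, Prop. 3.2.1 (proof, arXiv:1512.06894 pp. 10–11)]
[cite: Castella2018, proof of Thm. 2.3, (3.2.1) and (calcul) (arXiv:1704.06608 pp. 5–6)]
[cite: MilneADT2006, Ch. I, Thm. 4.10 and Thm. 2.8] -/
theorem natCard_level_eq_of_indices (hK : ∀ w : InfinitePlace K, w.IsComplex) (hk : 0 < k)
    (σ : K ≃ₐ[ℚ] K) (hσ : σ • 𝔭 = 𝔮) (h𝔮p : ((p : ℕ) : 𝓞 K) ∈ 𝔮.asIdeal) (hne : 𝔮 ≠ 𝔭)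
    (hall : ∀ v : HeightOneSpectrum (𝓞 K), ((p : ℕ) : 𝓞 K) ∈ v.asIdeal → v = 𝔭 ∨ v = 𝔮)
    (hPT : poitouTate_selmerStructure_duality K)
    (hEP : ∀ v : HeightOneSpectrum (𝓞 K), localEulerPoincareCharacteristic (v.adicCompletion K))
    (T : Finset (Place K)) (hinf : ∀ w : InfinitePlace K, (Sum.inl w : Place K) ∈ T)
    (hpT : ∀ v : HeightOneSpectrum (𝓞 K), ((p : ℕ) : 𝓞 K) ∈ v.asIdeal → (Sum.inr v : Place K) ∈ T)
    (hbad : ∀ v : HeightOneSpectrum (𝓞 K), ¬ (W.baseChange K).HasGoodReductionAt v →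
      (Sum.inr v : Place K) ∈ T)
    (h𝔮T : (Sum.inr 𝔮 : Place K) ∈ T)
    (hE : ∀ P : (W.baseChange K).toAffine.Point, p • P = 0 → P = 0)
    {e s j S : ℕ} (hjk : e + j ≤ k) (hsk : s + (e + j) ≤ k)
    (hN : ((zsmulAddGroupHom ((p ^ k : ℕ) : ℤ) : (W.baseChange K).toAffine.Point →+ _).range).index =
      p ^ k)
    (hM : (AddCommGroup.torsion ((W.baseChange K).baseChange (𝔭.adicCompletion K)).toAffine.Point ⊔
        (zsmulAddGroupHom ((p ^ k : ℕ) : ℤ) :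
          ((W.baseChange K).baseChange (𝔭.adicCompletion K)).toAffine.Point →+ _).range).index = p ^ k)
    (hL₁ : ((Affine.Point.baseChange (W' := W.baseChange K) K (𝔭.adicCompletion K)).range ⊔
        (zsmulAddGroupHom ((p ^ k : ℕ) : ℤ) :
          ((W.baseChange K).baseChange (𝔭.adicCompletion K)).toAffine.Point →+ _).range).index = p ^ e)
    (hL₁' : ((Affine.Point.baseChange (W' := W.baseChange K) K (𝔭.adicCompletion K)).range ⊔
        (zsmulAddGroupHom ((p ^ (k - j) : ℕ) : ℤ) :
          ((W.baseChange K).baseChange (𝔭.adicCompletion K)).toAffine.Point →+ _).range).index = p ^ e)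
    (hL₂ : ((Affine.Point.baseChange (W' := W.baseChange K) K (𝔭.adicCompletion K)).range ⊔
        (AddCommGroup.torsion ((W.baseChange K).baseChange (𝔭.adicCompletion K)).toAffine.Point ⊔
          (zsmulAddGroupHom ((p ^ k : ℕ) : ℤ) :
            ((W.baseChange K).baseChange (𝔭.adicCompletion K)).toAffine.Point →+ _).range)).index =
      p ^ s)
    (hL₂' : ((Affine.Point.baseChange (W' := W.baseChange K) K (𝔭.adicCompletion K)).range ⊔
        (AddCommGroup.torsion ((W.baseChange K).baseChange (𝔭.adicCompletion K)).toAffine.Point ⊔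
          (zsmulAddGroupHom ((p ^ (k - (e + j)) : ℕ) : ℤ) :
            ((W.baseChange K).baseChange (𝔭.adicCompletion K)).toAffine.Point →+ _).range)).index =
      p ^ s)
    (hS : Nat.card ↥((W.baseChange K).sha ⊓
        AddSubgroup.torsionBy (W.baseChange K).galH1 ((p ^ k : ℕ) : ℤ)) = S)
    (hShaj : ∀ z ∈ (W.baseChange K).sha ⊓
        AddSubgroup.torsionBy (W.baseChange K).galH1 ((p ^ k : ℕ) : ℤ), p ^ j • z = 0) :
    Finite (acLevelStructure (W.baseChange K) p k 𝔭 ∅).selmerGroup ∧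
      Nat.card (acLevelStructure (W.baseChange K) p k 𝔭 ∅).selmerGroup = S * p ^ (e + s) := by
  haveI hEK : (W.baseChange K).IsElliptic := by rw [baseChange]; infer_instance
  have hp : p.Prime := Fact.out
  haveI : NeZero (p ^ k) := ⟨pow_ne_zero _ hp.ne_zero⟩
  haveI : CharZero (𝔭.adicCompletion K) := charZero_adicCompletion 𝔭
  haveI : CharZero (𝔮.adicCompletion K) := charZero_adicCompletion 𝔮
  have hnZ : ((p ^ k : ℕ) : ℤ) ≠ 0 := Int.natCast_ne_zero.mpr (NeZero.ne _)
  set E := W.baseChange K with hE_def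
  have hdiv := E.zsmul_geomPoints_surjective_holds hnZ
  set Sel := selmerGroup E ((p ^ k : ℕ) : ℤ) with hSel
  set KO := kummerOutside E (p ^ k) {Sum.inr 𝔮} with hKO
  have hSelKO : Sel ≤ KO := selmerGroup_le_kummerOutside E (p ^ k) _
  haveI hKOfin : Finite KO := SelmerLevelBound.finite_kummerOutside E (p ^ k) {Sum.inr 𝔮}
  have hppos : ∀ t : ℕ, 0 < p ^ t := fun t => pow_pos hp.pos t
  -- the glue with Castella's level group (gen 19, file A)
  have hglue := LevelKummer.selmerGroup_acLevelStructure_eq_inf_torsion E p k 𝔭 𝔮 hK h𝔮p hne hall hnZ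
  ------------------------------------------------------------------
  -- §A. AT `𝔮`: `[KO : Sel] = [𝓛_𝔮 : loc_𝔮 Sel] = p^e`
  ------------------------------------------------------------------
  set res𝔮 := galoisCohomology.res (E.torsionGaloisModule ((p ^ k : ℕ) : ℤ)) (𝔮.adicCompletion K) 1
    with hres𝔮
  set κ𝔮 := E.localKummerMap (𝔮.adicCompletion K) hnZ with hκ𝔮
  set ι𝔮 := Affine.Point.baseChange (W' := E) K (𝔮.adicCompletion K) with hι𝔮
  set L𝔮 := E.kummerLocalConditionAt ((p ^ k : ℕ) : ℤ) (𝔮.adicCompletion K) with hL𝔮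
  set HS := Sel.map res𝔮 with hHS
  set A₁ := ((kummerMapTorsion E ((p ^ k : ℕ) : ℤ) hdiv).range).map res𝔮 with hA₁
  set A₂ := (ι𝔮.range ⊔ (zsmulAddGroupHom ((p ^ (k - j) : ℕ) : ℤ) :
      (E.baseChange (𝔮.adicCompletion K)).toAffine.Point →+ _).range).map κ𝔮 with hA₂
  have hκSel : (kummerMapTorsion E ((p ^ k : ℕ) : ℤ) hdiv).range ≤ Sel := by
    rintro _ ⟨P, rfl⟩
    exact StrictAtPlace.kummerMapTorsion_mem_selmerGroup E hdiv P
  have hA₁_le : A₁ ≤ HS := AddSubgroup.map_mono hκSel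
  have hL𝔮range : κ𝔮.range = L𝔮 := E.range_localKummerMap _ hnZ
  -- `loc_𝔮 Sel ⊆ κ_𝔮(im E(K) + p^{k-j} E(K_𝔮))` (gen 19, file B)
  have hdvd : ((p ^ j : ℕ) : ℤ) ∣ ((p ^ k : ℕ) : ℤ) :=
    Int.natCast_dvd_natCast.mpr (pow_dvd_pow p (by omega))
  have hjZ : ((p ^ j : ℕ) : ℤ) ≠ 0 := Int.natCast_ne_zero.mpr (pow_ne_zero _ hp.ne_zero)
  have hmul : ((p ^ k : ℕ) : ℤ) = ((p ^ (k - j) : ℕ) : ℤ) * ((p ^ j : ℕ) : ℤ) := by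
    rw [← Nat.cast_mul, ← pow_add, Nat.sub_add_cancel (by omega)]
  have hShale : E.sha ⊓ AddSubgroup.torsionBy E.galH1 ((p ^ k : ℕ) : ℤ) ≤
      AddSubgroup.torsionBy E.galH1 ((p ^ j : ℕ) : ℤ) :=
    fun z hz => AddSubgroup.torsionBy.nsmul_iff.mpr (hShaj z hz)
  have hHS_le : HS ≤ A₂ := by
    rintro _ ⟨s', hs', rfl⟩
    exact KummerDecomp.res_mem_map_localKummerMap_of_mem_selmerGroup E hdvd hjZ hnZ hmul hShale
      (Sum.inr 𝔮) hs'
  have hA₂_le : A₂ ≤ L𝔮 := by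
    rw [← hL𝔮range]
    exact AddSubgroup.map_le_range _ _
  -- `[𝓛_𝔮 : κ_𝔮(im E(K))] = [E(K_𝔮) : im E(K) + nE(K_𝔮)] = (symmetry) p^e`
  have hA₁L : A₁.relIndex L𝔮 = p ^ e := by
    rw [hA₁, hL𝔮, KummerIndex.relIndex_map_res_range_kummerMapTorsion E (𝔮.adicCompletion K) hnZ hdiv,
      ← LocalIndexSymmetry.index_range_baseChange_sup_eq_of_algEquiv_smul W σ hσ ((p ^ k : ℕ) : ℤ),
      hL₁]
  -- `[𝓛_𝔮 : κ_𝔮(im E(K) + p^{k-j}E)] = [E(K_𝔮) : im E(K) + p^{k-j}E(K_𝔮)] = p^e`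
  have hA₂L : A₂.relIndex L𝔮 = p ^ e := by
    rw [hA₂, ← hL𝔮range, KummerIndex.relIndex_map_range_eq_index_sup_ker, hκ𝔮,
      E.ker_localKummerMap _ hnZ,
      sup_eq_left.mpr (le_sup_of_le_right (range_zsmul_pow_le_of_le p (Nat.sub_le k j))),
      ← LocalIndexSymmetry.index_range_baseChange_sup_eq_of_algEquiv_smul W σ hσ
        ((p ^ (k - j) : ℕ) : ℤ), hL₁']
  have hHSL : HS.relIndex L𝔮 = p ^ e :=
    SelmerCount.relIndex_eq_of_squeeze_above hA₁_le hHS_le hA₂_le (pow_ne_zero _ hp.ne_zero)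
      hA₁L hA₂L
  -- Poitou–Tate, both halves (gen 19, file D)
  have hD := Relaxation.relIndex_selmerGroup_kummerOutside_eq E p k 𝔮 hK hPT hEP hk.ne' T hinf hpT
    hbad h𝔮T
  have hB : Sel.relIndex KO = p ^ e := by
    rw [hSel, hKO, hD]
    exact hHSL
  -- `p^e` kills `𝓛_𝔮 / loc_𝔮 Sel`, hence `p^e KO ⊆ Sel` and `p^{e+j} KO ⊆ κ_n(E(K))`
  have hc : ∀ y ∈ E.kummerSelmerStructure ((p ^ k : ℕ) : ℤ) (Sum.inr 𝔮),
      p ^ e • y ∈ (selmerGroup E ((p ^ k : ℕ) : ℤ)).map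
        (galoisCohomology.localization (E.torsionGaloisModule ((p ^ k : ℕ) : ℤ)) (Sum.inr 𝔮) 1) :=
    fun y hy => SelmerCount.nsmul_mem_of_relIndex_eq hA₁_le hA₁L hy
  have hSelc : ∀ x ∈ KO, p ^ e • x ∈ Sel := fun x hx =>
    Relaxation.nsmul_mem_selmerGroup_of_mem_kummerOutside E p k 𝔮 hPT hEP hk.ne' (p ^ e) hc hx
  have hX : ∀ x ∈ KO, p ^ (e + j) • x ∈
      (kummerMapTorsion E ((p ^ k : ℕ) : ℤ) (E.zsmul_geomPoints_surjective_holds hnZ)).range := by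
    intro x hx
    rw [pow_add, mul_nsmul]
    exact KummerDecomp.nsmul_mem_range_kummerMapTorsion_of_mem_selmerGroup E hnZ (p ^ j) hShaj
      (hSelc x hx)
  ------------------------------------------------------------------
  -- §B. AT `𝔭`: `[KO : C'] = [κ_𝔭(T) + loc_𝔭 KO : κ_𝔭(T)] = p^{k-s}`
  ------------------------------------------------------------------
  set res𝔭 := galoisCohomology.res (E.torsionGaloisModule ((p ^ k : ℕ) : ℤ)) (𝔭.adicCompletion K) 1
    with hres𝔭
  set κ𝔭 := E.localKummerMap (𝔭.adicCompletion K) hnZ with hκ𝔭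
  set ι𝔭 := Affine.Point.baseChange (W' := E) K (𝔭.adicCompletion K) with hι𝔭
  set T𝔭 := AddCommGroup.torsion (E.baseChange (𝔭.adicCompletion K)).toAffine.Point with hT𝔭
  set Rk := (zsmulAddGroupHom ((p ^ k : ℕ) : ℤ) :
      (E.baseChange (𝔭.adicCompletion K)).toAffine.Point →+ _).range with hRk
  set Rc := (zsmulAddGroupHom ((p ^ (k - (e + j)) : ℕ) : ℤ) :
      (E.baseChange (𝔭.adicCompletion K)).toAffine.Point →+ _).range with hRc
  set Tκ := T𝔭.map κ𝔭 with hTκ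
  set X := Tκ ⊔ KO.map res𝔭 with hX_def
  set M₁ := (ι𝔭.range ⊔ (T𝔭 ⊔ Rk)).map κ𝔭 with hM₁
  set M₂ := (ι𝔭.range ⊔ (T𝔭 ⊔ Rc)).map κ𝔭 with hM₂
  have hkerκ : κ𝔭.ker = Rk := E.ker_localKummerMap _ hnZ
  have hRle : Rk ≤ Rc := range_zsmul_pow_le_of_le p (Nat.sub_le k (e + j))
  -- `KO` is Kummer at `𝔭`
  have hXE : ∀ x ∈ KO, res𝔭 x ∈ E.kummerLocalConditionAt ((p ^ k : ℕ) : ℤ) (𝔭.adicCompletion K) := by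
    intro x hx
    have h𝔭𝔮 : (Sum.inr 𝔭 : Place K) ∉ ({Sum.inr 𝔮} : Finset (Place K)) := fun h =>
      hne.symm (Sum.inr_injective (Finset.mem_singleton.mp h))
    exact (mem_kummerOutside_iff E (p ^ k) {Sum.inr 𝔮} x).mp hx (Sum.inr 𝔭) h𝔭𝔮
  -- `loc_𝔭 KO ⊆ κ_𝔭(im E(K) + T + p^{k-e-j}E(K_𝔭))` (gen 19, file B)
  have hup : KO.map res𝔭 ≤ M₂ := by
    rintro _ ⟨x, hx, rfl⟩
    exact KummerDecomp.res_mem_map_of_nsmul_le_range E hnZ p k rfl hE KO hjk hX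
      (𝔭.adicCompletion K) hXE hx
  have h0 : Tκ ≤ M₁ := AddSubgroup.map_mono (le_sup_of_le_right le_sup_left)
  have h1 : M₁ ≤ X := by
    rintro _ ⟨P, hP, rfl⟩
    obtain ⟨a, ha, b, hb, rfl⟩ := AddSubgroup.mem_sup.mp hP
    obtain ⟨t, ht, r, hr, rfl⟩ := AddSubgroup.mem_sup.mp hb
    obtain ⟨Q, rfl⟩ := ha
    have hr0 : κ𝔭 r = 0 := by rw [← AddMonoidHom.mem_ker, hkerκ]; exact hr
    rw [map_add, map_add, hr0, add_zero, add_comm]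
    refine AddSubgroup.add_mem _ (AddSubgroup.mem_sup_left ⟨t, ht, rfl⟩)
      (AddSubgroup.mem_sup_right ⟨kummerMapTorsion E _ hdiv Q, hSelKO (hκSel ⟨Q, rfl⟩), ?_⟩)
    exact KummerIndex.res_kummerMapTorsion_eq_localKummerMap E (𝔭.adicCompletion K) hnZ hdiv Q
  have h2 : X ≤ M₂ :=
    sup_le (AddSubgroup.map_mono (le_sup_of_le_right le_sup_left)) hup
  -- `[κ_𝔭(im E(K) + T + nE) : κ_𝔭(T)] = [E : T + nE] / [E : im E(K) + T + nE] = p^k / p^s`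
  have hM₁T : Tκ.relIndex M₁ = p ^ (k - s) := by
    have hle : T𝔭 ⊔ Rk ≤ ι𝔭.range ⊔ (T𝔭 ⊔ Rk) := le_sup_right
    have hmul := AddSubgroup.relIndex_mul_index hle
    rw [hL₂, hM] at hmul
    rw [hTκ, hM₁, AddSubgroup.relIndex_map_map, hkerκ,
      sup_eq_left.mpr (le_sup_of_le_right le_sup_right)]
    refine Nat.eq_of_mul_eq_mul_right (hppos s) ?_
    rw [hmul, ← pow_add, Nat.sub_add_cancel (by omega)]
  have hM₂T : Tκ.relIndex M₂ = p ^ (k - s) := by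
    have hle : T𝔭 ⊔ Rk ≤ ι𝔭.range ⊔ (T𝔭 ⊔ Rc) :=
      le_sup_of_le_right (sup_le le_sup_left (le_sup_of_le_right hRle))
    have hmul := AddSubgroup.relIndex_mul_index hle
    rw [hL₂', hM] at hmul
    rw [hTκ, hM₂, AddSubgroup.relIndex_map_map, hkerκ,
      sup_eq_left.mpr (le_sup_of_le_right (le_sup_of_le_right hRle))]
    refine Nat.eq_of_mul_eq_mul_right (hppos s) ?_
    rw [hmul, ← pow_add, Nat.sub_add_cancel (by omega)]
  have hTX : Tκ.relIndex X = p ^ (k - s) :=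
    SelmerCount.relIndex_eq_of_squeeze_below h0 h1 h2 (pow_ne_zero _ hp.ne_zero) hM₁T hM₂T
  have hC : (KO ⊓ Tκ.comap res𝔭).relIndex KO = p ^ (k - s) := by
    rw [AddSubgroup.inf_relIndex_left, AddSubgroup.relIndex_comap]
    have h := hTX
    rwa [hX_def, AddSubgroup.relIndex_sup_left] at h
  ------------------------------------------------------------------
  -- §C. COUNT: `#C'·[KO : C'] = #KO = #Sel·[KO : Sel]`, `#Sel = n·S`
  ------------------------------------------------------------------
  have hSelcard : Nat.card Sel = p ^ k * S := by
    rw [hSel, SelmerCount.natCard_selmerGroup_eq_index_mul E hnZ, hN, hS]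
  have h₁ := SelmerCount.card_mul_relIndex_of_le hSelKO
  have h₂ := SelmerCount.card_mul_relIndex_of_le (inf_le_left : KO ⊓ Tκ.comap res𝔭 ≤ KO)
  rw [hB, hSelcard] at h₁
  rw [hC] at h₂
  have h₃ : Nat.card ↥(KO ⊓ Tκ.comap res𝔭) * p ^ (k - s) = p ^ k * S * p ^ e := h₂.trans h₁.symm
  have hcard : Nat.card ↥(KO ⊓ Tκ.comap res𝔭) = S * p ^ (e + s) := by
    refine Nat.eq_of_mul_eq_mul_right (hppos (k - s)) ?_
    rw [h₃]
    have hks : k = (k - s) + s := (Nat.sub_add_cancel (by omega)).symm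
    conv_lhs => rw [hks]
    ring
  refine ⟨?_, ?_⟩
  · rw [hglue]
    change Finite ↥(KO ⊓ Tκ.comap res𝔭)
    exact Finite.of_injective _ (AddSubgroup.inclusion_injective inf_le_left)
  · rw [hglue]
    change Nat.card ↥(KO ⊓ Tκ.comap res𝔭) = _
    exact hcard

end Summit.BirchSwinnertonDyer.Rank1Residual.X11b.SelmerLevelCount

end
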